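/-
Copyright (c) 2026 the pub-hodgecm-mathlib formalisation cell (harness21).  Prover seat hodgecm-mathlib-K2E4-p10 (g6), Track B ∕ K2-LIT, h413 =
`stmt-HodgeConjecture-24833`, line `K2_E1_TraceFormulaBeta`, rung (ρ2) «cusp forms have mean zero» — ROAD B «SOFT MEAN-ZERO», the CM INSTANCES (dealer K2E1-plan (g6) WAVE 1 (1),
2026-09-04T09:52:04Z); sibling of `K2E1CuspFormsMeanZeroSoftU` (400-line law).
-/
import Summits.HodgeConjecture.HodgeConjecture.Theorems.K2E1CuspFormsMeanZeroSoftU              -- THIS SEAT: the every-rank head `integral_eq_zero_of_mem_cuspForms` (ergodicity + the Eisenstein witness)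
import Summits.HodgeConjecture.HodgeConjecture.Theorems.K2E1CuspidalSpectrumUnitaryDefsR       -- ★ (K2E1-p02 g0): `cmParabolicDataR`, `cmCuspFormsR`, `cmResidualSubspaceR` (the printed radicals at `N = 3`)
import Summits.HodgeConjecture.HodgeConjecture.Theorems.K2E1BLReductionCoveringU2             -- ★ BL-R1 (K2E1-p08 g6): `exists_ncard_setOf_lt_borelHeight_le_cm`, `exists_pos_forall_exists_lt_borelHeight_mul_cm`
import Summits.HodgeConjecture.HodgeConjecture.Theorems.K2E1BLReductionCoveringU3             -- ★ BL-R1₃ (K2E1-p02 g6): `exists_ncard_setOf_lt_borelHeight_le_cm_three`, `exists_pos_forall_exists_lt_borelHeight_mul_cm_three`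
import Summits.HodgeConjecture.HodgeConjecture.Theorems.K2E1IntertwinedSectionInvariance      -- ★ `map_conj_toAdelic_eq_self_two ∕ _three` (FILE A's `hconj`)
import Summits.HodgeConjecture.HodgeConjecture.Theorems.K2E1HeisenbergHaarU3                  -- ★ (ν-2): `isInvInvariant_of_isHaarMeasure_adelicUnipotent_three`
import Summits.HodgeConjecture.HodgeConjecture.Theorems.K2E1UnipotentHaarNormalisationU2      -- ★ (D1-a): `isInvInvariant_of_isHaarMeasure_two`, `exists_isFundamentalDomain_two`
import Summits.HodgeConjecture.HodgeConjecture.Theorems.K2E1BorelLeviUDomains                 -- ★ (K2E1-p09 g2): `exists_isFundamentalDomain_of_eq_three`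
import Summits.HodgeConjecture.HodgeConjecture.Theorems.K2E1SiegelRadicalCocompactU2          -- ★ `upperUnitriangular_eq_standardUnipotentRadical_two` (the `N = 2` radical dictionary)
import Summits.HodgeConjecture.HodgeConjecture.Theorems.K2E1HeisenbergRadicalCocompactU3      -- ★ `upperUnitriangular_eq_flagUnipotentRadical_three` (the `N = 3` radical dictionary)
import Literature.NumberTheory.Automorphic.UnitaryGroupTruncationFiniteSum                    -- ★ `finite_setOf_lt_borelHeight` (`N = 3`)
import Literature.NumberTheory.Automorphic.UnitaryGroupTruncationFiniteSumTwo                 -- ★ `finite_setOf_lt_borelHeight_two`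
import Literature.NumberTheory.Automorphic.UnitaryGroupQuasiSplitCMDatum                      -- ★ `antidiagOne_eq_over` ∕ `quasiSplit_eq_cmDatum_of` (Mok's datum IS the route's `cmDatum L N Φ_N`)
import Literature.NumberTheory.Automorphic.AdelicUnitaryGroupUnimodularQuasiSplit             -- ★ `forall_isHaarMeasure_isMulRightInvariant_quasiSplit_cm` (`U(J_N)(𝔸)` unimodular)
import Literature.NumberTheory.Automorphic.UnitaryGroupUnipotentUnimodularThree               -- ★ `measure_ne_zero_of_isFundamentalDomain_rationalUnipotent`
import Literature.NumberTheory.Automorphic.GLnIwasawaIntegration                              -- ★ `isInvInvariant_of_isMulRightInvariant`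
import HarnessLib

/-!
# K2·E1 — `K2E1CuspFormsMeanZeroSoftUCM`: CUSP FORMS OF `U(1,1)_{L∕L⁺}` AND `U(2,1)_{L∕L⁺}` HAVE MEAN ZERO, LETTER-FREE; THE CONSTANT LINE IS RESIDUAL (rung (ρ2), both ranks)

Track B ∕ K2-LIT, crux h413 = `stmt-HodgeConjecture-24833`, route of record `HCCMUnconditional`; cell `hodgecm-mathlib`, squad K2, ENGINE E1.  Prover seat `hodgecm-mathlib-K2E4-p10`
(g6); ROAD B «SOFT MEAN-ZERO» of the dealer K2E1-plan (g6) — the CM instances of the every-rank head ★ `K2E1CuspFormsMeanZeroSoftU.integral_eq_zero_of_mem_cuspForms` (ergodicity of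
`G(𝔸)` on `X` + the Borel Eisenstein series of the height cut-off as the witness `u ⊥ L²_cusp`, `⟪u, 𝟙⟫ ≠ 0`; no Eisenstein continuation, no residue, no decay letter).
THEOREMS ONLY (no `def`, no `instance`, no notation, no named-fact hypothesis, no `sorry`); lane `--supports stmt-HodgeConjecture-24833 --as helper` (count-neutral).  Closes no socket.

* §1 `N = 2` (Mok's currency `quasiSplit L⁺ L c 2`, abstract `𝔓` with `𝔓.radical i = N(𝔸)`): **`integral_eq_zero_of_mem_cuspForms_cm_two`** — every binder of the every-rank head is ★:
  `ν_G` = Haar (inversion-invariant: unimodular ★ + ★ `isInvInvariant_of_isMulRightInvariant`), `ν_N` = Haar on the closed subgroup `N(𝔸)` (★ `isInvInvariant_of_isHaarMeasure_two`, `hconj` ★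
  `map_conj_toAdelic_eq_self_two`), Tate's domain ★ `exists_isFundamentalDomain_two`, the floor ★ `exists_pos_forall_exists_lt_borelHeight_mul_cm`, finiteness ★
  `finite_setOf_lt_borelHeight_two`, the count ★ `exists_ncard_setOf_lt_borelHeight_le_cm`.
* §2 `N = 3`: **`integral_eq_zero_of_mem_cuspForms_cm_three`** (★ `isInvInvariant_of_isHaarMeasure_adelicUnipotent_three`, ★ `map_conj_toAdelic_eq_self_three`, ★
  `exists_isFundamentalDomain_of_eq_three` + ★ `measure_ne_zero_of_isFundamentalDomain_rationalUnipotent`, ★ the `_three` reduction theory).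
* §3 THE ROUTE'S LITERAL DATUM `cmDatum L N Φ_N` (transport by `subst` along `J = (StdForm.antidiagonal N).over L` ★ `antidiagOne_eq_over`, `quasiSplit = cmDatum` being `rfl`, and
  the radical dictionaries ★ `upperUnitriangular_eq_standardUnipotentRadical_two` ∕ ★ `upperUnitriangular_eq_flagUnipotentRadical_three`): **`hmean_cm_two`** — `∀ φ ∈ cmCuspForms L 2 μ,
  ∫ φ dμ = 0`, the EXACT letter of ★ `span_const_le_cmResidualSubspace`; **`hmean_cm_threeR`** — `∀ φ ∈ cmCuspFormsR L 3 μ, ∫ φ dμ = 0` (the PRINTED cusp forms of `U(2,1)`, full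
  Heisenberg radical ★ `cmParabolicDataR`); and the LETTER-FREE rungs **`span_const_le_cmResidualSubspace_two`** (`ℂ ∙ 𝟙 ≤ L²_res(U(Φ₂))`) and
  **`span_const_le_cmResidualSubspaceR_three`** (`ℂ ∙ 𝟙 ≤ L²_res(U(Φ₃))`, printed radicals): «the constant line is residual», unconditional at both ranks.
NOT HERE: the centre-only class `cmCuspForms L 3` (★ erratum R1-46) — its mean-zero needs `cmCuspForms L 3 ≤ cmCuspFormsR L 3` (a Fubini over `Z ⊲ N`), not in the tree.
HONEST LABEL: HC_CM is proved only modulo the 7 printed citations (2 remaining named inputs: hLiu418 = `stmt-HodgeConjecture-24832`, h413 = `stmt-HodgeConjecture-24833`) until rung 0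
closes; this file asserts no named fact and closes no socket.
References: [MoeglinWaldspurger1995] I.2.18, II.1.7–II.1.8 · [BorelJacquet1979] §4.4–§4.6 · [Zimmer1984] §2.2 · [Rogawski1990] §13.5 · [CasselsFrohlichANT1967] Ch. XV Thm. 4.1.3.
-/

set_option autoImplicit false
-- the mandated namespace repeats the single-problem summit's segment (`HodgeConjecture.HodgeConjecture`)
set_option linter.dupNamespace false

noncomputable section

open MeasureTheory Measure NumberField IsDedekindDomain Set MulAction ContRepresentation
open scoped ENNReal NNReal ComplexConjugate InnerProductSpace
open Literature.MeasureTheory.Group Literature.NumberTheory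
open Literature.NumberTheory.Automorphic Literature.NumberTheory.Automorphic.UnitaryGroup AdelicGroupData
open Summit.HodgeConjecture.HodgeConjecture.Cruxes.H413.K2E1ConstantLineResidualU2 (span_const_le_residualSubspace span_const_le_cmResidualSubspace)
open Summit.HodgeConjecture.HodgeConjecture.Cruxes.H413.K2E1CuspidalSpectrumUnitary
open Summit.HodgeConjecture.HodgeConjecture.Cruxes.H413.K2E1CuspFormsMeanZeroSoftU (integral_eq_zero_of_mem_cuspForms)

namespace Summit.HodgeConjecture.HodgeConjecture.Cruxes.H413.K2E1CuspFormsMeanZeroSoftUCM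

/-! ## §1–§2 The CM pair `(L⁺, L)`, `N = 2` and `N = 3`: every binder of the every-rank head discharged -/

section CMTwo

variable (L : Type) [Field L] [NumberField L] [IsCMField L]
variable [MeasurableSpace (quasiSplit (↥(maximalRealSubfield L)) L (IsCMField.complexConj L) 2).Adelic] [BorelSpace (quasiSplit (↥(maximalRealSubfield L)) L (IsCMField.complexConj L) 2).Adelic]

/-- **CUSP FORMS OF `U(1,1)_{L∕L⁺}` HAVE MEAN ZERO — LETTER-FREE** (Mok's currency, abstract parabolic data `𝔓` with `𝔓.radical i = N(𝔸)`): every binder of §3 is ★ at the CM pair —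
`ν_G` = Haar (inversion-invariant: `U(J₂)(𝔸)` is unimodular ★ `forall_isHaarMeasure_isMulRightInvariant_quasiSplit_cm`, ★ `isInvInvariant_of_isMulRightInvariant`), `ν_N` = Haar on the
closed subgroup `N(𝔸)` (inversion-invariant ★ `isInvInvariant_of_isHaarMeasure_two`, `hconj` ★ `map_conj_toAdelic_eq_self_two`), Tate's fundamental domain ★ `exists_isFundamentalDomain_two`,
the floor ★ `exists_pos_forall_exists_lt_borelHeight_mul_cm`, finiteness ★ `finite_setOf_lt_borelHeight_two`, the count ★ `exists_ncard_setOf_lt_borelHeight_le_cm`.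
[cite: MoeglinWaldspurger1995, I.2.18] [cite: BorelJacquet1979, §4.6] [cite: Zimmer1984, §2.2] -/
theorem integral_eq_zero_of_mem_cuspForms_cm_two
    (μ : Measure (quasiSplit (↥(maximalRealSubfield L)) L (IsCMField.complexConj L) 2).automorphicQuotient) [(quasiSplit (↥(maximalRealSubfield L)) L (IsCMField.complexConj L) 2).IsAutomorphicMeasure μ]
    (𝔓 : (quasiSplit (↥(maximalRealSubfield L)) L (IsCMField.complexConj L) 2).ParabolicUnipotentData) (i : 𝔓.ι)
    (h𝔓 : 𝔓.radical i = adelicUnipotent (↥(maximalRealSubfield L)) L (IsCMField.complexConj L) 2) :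
    ∀ φ ∈ (quasiSplit (↥(maximalRealSubfield L)) L (IsCMField.complexConj L) 2).cuspForms μ 𝔓, ∫ x, φ x ∂μ = 0 := by
  haveI := t2Space_adeleRing_of_numberField L
  haveI := locallyCompactSpace_adeleRing' L
  haveI := secondCountableTopology_adeleRing L
  haveI : T2Space (quasiSplit (↥(maximalRealSubfield L)) L (IsCMField.complexConj L) 2).Adelic :=
    inferInstanceAs (T2Space (adelic (↥(maximalRealSubfield L)) L (IsCMField.complexConj L) 2 ((StdForm.antidiagonal 2).over L)))
  haveI : LocallyCompactSpace (quasiSplit (↥(maximalRealSubfield L)) L (IsCMField.complexConj L) 2).Adelic :=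
    inferInstanceAs (LocallyCompactSpace (adelic (↥(maximalRealSubfield L)) L (IsCMField.complexConj L) 2 ((StdForm.antidiagonal 2).over L)))
  haveI : SecondCountableTopology (quasiSplit (↥(maximalRealSubfield L)) L (IsCMField.complexConj L) 2).Adelic :=
    inferInstanceAs (SecondCountableTopology (adelic (↥(maximalRealSubfield L)) L (IsCMField.complexConj L) 2 ((StdForm.antidiagonal 2).over L)))
  have hc : (IsCMField.complexConj L) * (IsCMField.complexConj L) = 1 := AlgEquiv.ext fun x => IsCMField.complexConj_apply_apply L x
  have hc1 : (IsCMField.complexConj L) ≠ 1 := IsCMField.complexConj_ne_one L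
  have hij : (((0 : Fin 2) : ℕ)) + 1 = ((1 : Fin 2) : ℕ) := rfl
  have hN : 2 = 2 * ((0 : Fin 2) : ℕ) + 2 := rfl
  -- `ν_G`: a Haar measure of the unimodular group `U(J₂)(𝔸)`, inversion-invariant
  haveI : (haar : Measure (quasiSplit (↥(maximalRealSubfield L)) L (IsCMField.complexConj L) 2).Adelic).IsMulRightInvariant :=
    forall_isHaarMeasure_isMulRightInvariant_quasiSplit_cm L (le_refl 2) haar inferInstance
  haveI : (haar : Measure (quasiSplit (↥(maximalRealSubfield L)) L (IsCMField.complexConj L) 2).Adelic).IsInvInvariant := isInvInvariant_of_isMulRightInvariant _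
  -- `ν_N`: a Haar measure of the closed subgroup `N(𝔸)`, inversion-invariant, with Tate's fundamental domain
  have hcl : IsClosed ((adelicUnipotent (↥(maximalRealSubfield L)) L (IsCMField.complexConj L) 2 : Set (quasiSplit (↥(maximalRealSubfield L)) L (IsCMField.complexConj L) 2).Adelic)) := by
    change IsClosed (⇑(adelicVal (↥(maximalRealSubfield L)) L (IsCMField.complexConj L) 2 ((StdForm.antidiagonal 2).over L)) ⁻¹'
      ((upperUnitriangular (Fin 2) (AdeleRing (𝓞 L) L) : Subgroup (GL (Fin 2) (AdeleRing (𝓞 L) L))) : Set (GL (Fin 2) (AdeleRing (𝓞 L) L))))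
    exact (isClosed_upperUnitriangular (R := AdeleRing (𝓞 L) L)).preimage continuous_subtype_val
  haveI : LocallyCompactSpace ↥(adelicUnipotent (↥(maximalRealSubfield L)) L (IsCMField.complexConj L) 2) := hcl.locallyCompactSpace
  haveI : (haar : Measure ↥(adelicUnipotent (↥(maximalRealSubfield L)) L (IsCMField.complexConj L) 2)).IsInvInvariant :=
    K2E1UnipotentHaarNormalisationU2.isInvInvariant_of_isHaarMeasure_two _
  letI : MeasurableSpace (AdeleRing (𝓞 L) L) := borel _
  haveI : BorelSpace (AdeleRing (𝓞 L) L) := ⟨rfl⟩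
  obtain ⟨𝓕, h𝓕, -, h𝓕₀, h𝓕top⟩ := K2E1UnipotentHaarNormalisationU2.exists_isFundamentalDomain_two hij hN hc
    (haar : Measure ↥(adelicUnipotent (↥(maximalRealSubfield L)) L (IsCMField.complexConj L) 2))
  -- reduction theory: the floor, finiteness, the uniform count
  obtain ⟨T, hT, hcov⟩ := K2E1BLReductionCoveringU2.exists_pos_forall_exists_lt_borelHeight_mul_cm L
  obtain ⟨M, hM⟩ := K2E1BLReductionCoveringU2.exists_ncard_setOf_lt_borelHeight_le_cm L hT
  exact integral_eq_zero_of_mem_cuspForms μ haar haar (fun _ hb₀ => K2E1IntertwinedSectionInvariance.map_conj_toAdelic_eq_self_two hc hc1 _ hb₀) h𝓕 h𝓕₀ h𝓕top 𝔓 i h𝔓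
    (fun y => finite_setOf_lt_borelHeight_two y hT) hM hcov

end CMTwo

section CMThree

variable (L : Type) [Field L] [NumberField L] [IsCMField L]
variable [MeasurableSpace (quasiSplit (↥(maximalRealSubfield L)) L (IsCMField.complexConj L) 3).Adelic] [BorelSpace (quasiSplit (↥(maximalRealSubfield L)) L (IsCMField.complexConj L) 3).Adelic]

/-- **CUSP FORMS OF `U(2,1)_{L∕L⁺}` HAVE MEAN ZERO — LETTER-FREE** (Mok's currency, abstract `𝔓` with `𝔓.radical i = N(𝔸)` the Heisenberg radical): `ν_G` = Haar (unimodular ★), `ν_N` = Haar on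
`N(𝔸)` (inversion-invariant ★ `isInvInvariant_of_isHaarMeasure_adelicUnipotent_three`, `hconj` ★ `map_conj_toAdelic_eq_self_three`), Tate's domain ★ `exists_isFundamentalDomain_of_eq_three`
(positive mass ★ `measure_ne_zero_of_isFundamentalDomain_rationalUnipotent`), the floor ★ `exists_pos_forall_exists_lt_borelHeight_mul_cm_three`, finiteness ★ `finite_setOf_lt_borelHeight`,
the count ★ `exists_ncard_setOf_lt_borelHeight_le_cm_three`.  NO Eisenstein continuation, NO residue, NO (R-b)₃ majorant, NO decay letter.
[cite: MoeglinWaldspurger1995, I.2.18] [cite: BorelJacquet1979, §4.6] [cite: Zimmer1984, §2.2] -/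
theorem integral_eq_zero_of_mem_cuspForms_cm_three
    (μ : Measure (quasiSplit (↥(maximalRealSubfield L)) L (IsCMField.complexConj L) 3).automorphicQuotient) [(quasiSplit (↥(maximalRealSubfield L)) L (IsCMField.complexConj L) 3).IsAutomorphicMeasure μ]
    (𝔓 : (quasiSplit (↥(maximalRealSubfield L)) L (IsCMField.complexConj L) 3).ParabolicUnipotentData) (i : 𝔓.ι)
    (h𝔓 : 𝔓.radical i = adelicUnipotent (↥(maximalRealSubfield L)) L (IsCMField.complexConj L) 3) :
    ∀ φ ∈ (quasiSplit (↥(maximalRealSubfield L)) L (IsCMField.complexConj L) 3).cuspForms μ 𝔓, ∫ x, φ x ∂μ = 0 := by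
  haveI := t2Space_adeleRing_of_numberField L
  haveI := locallyCompactSpace_adeleRing' L
  haveI := secondCountableTopology_adeleRing L
  haveI : T2Space (quasiSplit (↥(maximalRealSubfield L)) L (IsCMField.complexConj L) 3).Adelic :=
    inferInstanceAs (T2Space (adelic (↥(maximalRealSubfield L)) L (IsCMField.complexConj L) 3 ((StdForm.antidiagonal 3).over L)))
  haveI : LocallyCompactSpace (quasiSplit (↥(maximalRealSubfield L)) L (IsCMField.complexConj L) 3).Adelic :=
    inferInstanceAs (LocallyCompactSpace (adelic (↥(maximalRealSubfield L)) L (IsCMField.complexConj L) 3 ((StdForm.antidiagonal 3).over L)))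
  haveI : SecondCountableTopology (quasiSplit (↥(maximalRealSubfield L)) L (IsCMField.complexConj L) 3).Adelic :=
    inferInstanceAs (SecondCountableTopology (adelic (↥(maximalRealSubfield L)) L (IsCMField.complexConj L) 3 ((StdForm.antidiagonal 3).over L)))
  have hc : (IsCMField.complexConj L) * (IsCMField.complexConj L) = 1 := AlgEquiv.ext fun x => IsCMField.complexConj_apply_apply L x
  have hc1 : (IsCMField.complexConj L) ≠ 1 := IsCMField.complexConj_ne_one L
  haveI : (haar : Measure (quasiSplit (↥(maximalRealSubfield L)) L (IsCMField.complexConj L) 3).Adelic).IsMulRightInvariant :=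
    forall_isHaarMeasure_isMulRightInvariant_quasiSplit_cm L (by norm_num : 2 ≤ 3) haar inferInstance
  haveI : (haar : Measure (quasiSplit (↥(maximalRealSubfield L)) L (IsCMField.complexConj L) 3).Adelic).IsInvInvariant := isInvInvariant_of_isMulRightInvariant _
  have hcl : IsClosed ((adelicUnipotent (↥(maximalRealSubfield L)) L (IsCMField.complexConj L) 3 : Set (quasiSplit (↥(maximalRealSubfield L)) L (IsCMField.complexConj L) 3).Adelic)) := by
    change IsClosed (⇑(adelicVal (↥(maximalRealSubfield L)) L (IsCMField.complexConj L) 3 ((StdForm.antidiagonal 3).over L)) ⁻¹'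
      ((upperUnitriangular (Fin 3) (AdeleRing (𝓞 L) L) : Subgroup (GL (Fin 3) (AdeleRing (𝓞 L) L))) : Set (GL (Fin 3) (AdeleRing (𝓞 L) L))))
    exact (isClosed_upperUnitriangular (R := AdeleRing (𝓞 L) L)).preimage continuous_subtype_val
  haveI : LocallyCompactSpace ↥(adelicUnipotent (↥(maximalRealSubfield L)) L (IsCMField.complexConj L) 3) := hcl.locallyCompactSpace
  haveI : (haar : Measure ↥(adelicUnipotent (↥(maximalRealSubfield L)) L (IsCMField.complexConj L) 3)).IsInvInvariant :=
    K2E1HeisenbergHaarU3.isInvInvariant_of_isHaarMeasure_adelicUnipotent_three hc _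
  obtain ⟨𝓕, h𝓕, h𝓕top⟩ := K2E1BorelLeviUDomains.exists_isFundamentalDomain_of_eq_three hc rfl inferInstance
    (haar : Measure ↥(adelicUnipotent (↥(maximalRealSubfield L)) L (IsCMField.complexConj L) 3)) inferInstance
  have h𝓕₀ : (haar : Measure ↥(adelicUnipotent (↥(maximalRealSubfield L)) L (IsCMField.complexConj L) 3)) 𝓕 ≠ 0 :=
    measure_ne_zero_of_isFundamentalDomain_rationalUnipotent _ h𝓕
  obtain ⟨T, hT, hcov⟩ := K2E1BLReductionCoveringU3.exists_pos_forall_exists_lt_borelHeight_mul_cm_three L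
  obtain ⟨M, hM⟩ := K2E1BLReductionCoveringU3.exists_ncard_setOf_lt_borelHeight_le_cm_three L hT
  exact integral_eq_zero_of_mem_cuspForms μ haar haar (fun _ hb₀ => K2E1IntertwinedSectionInvariance.map_conj_toAdelic_eq_self_three hc hc1 _ hb₀) h𝓕 h𝓕₀ h𝓕top.ne 𝔓 i h𝔓
    (fun y => finite_setOf_lt_borelHeight y hT) hM hcov

end CMThree

/-! ## §3 The route's literal datum `cmDatum L N Φ_N`: `hmean_cm_two`, `hmean_cm_threeR`, and the letter-free rungs «the constant line IS residual» -/

section Literal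

variable (L : Type) [Field L] [NumberField L] [IsCMField L]

/-- `N = 2`, `J` ANY form equal to `(StdForm.antidiagonal 2).over L` (transport by `subst`; the tree's Borel structure on `G(𝔸)`): cusp forms of `U(J)` whose radical at `i` is the Siegel
radical `U(J) ∩ (1 + 𝔫_1)` have mean zero (§4 + the dictionary ★ `upperUnitriangular_eq_standardUnipotentRadical_two`). [cite: MoeglinWaldspurger1995, I.2.18] -/
theorem integral_eq_zero_of_mem_cuspForms_of_over_eq_two {J : Matrix (Fin 2) (Fin 2) L} (hJ : (StdForm.antidiagonal 2).over L = J)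
    (μ : Measure (cmDatum L 2 J).automorphicQuotient) [(cmDatum L 2 J).IsAutomorphicMeasure μ]
    (𝔓 : (cmDatum L 2 J).ParabolicUnipotentData) (i : 𝔓.ι)
    (h𝔓 : 𝔓.radical i = (standardUnipotentRadical 2 1 (AdeleRing (𝓞 L) L)).comap (adelicVal (↥(maximalRealSubfield L)) L (IsCMField.complexConj L) 2 J)) :
    ∀ φ ∈ (cmDatum L 2 J).cuspForms μ 𝔓, ∫ x, φ x ∂μ = 0 := by
  subst hJ
  letI : MeasurableSpace (quasiSplit (↥(maximalRealSubfield L)) L (IsCMField.complexConj L) 2).Adelic := borel _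
  haveI : BorelSpace (quasiSplit (↥(maximalRealSubfield L)) L (IsCMField.complexConj L) 2).Adelic := ⟨rfl⟩
  haveI : (quasiSplit (↥(maximalRealSubfield L)) L (IsCMField.complexConj L) 2).IsAutomorphicMeasure μ :=
    inferInstanceAs ((cmDatum L 2 ((StdForm.antidiagonal 2).over L)).IsAutomorphicMeasure μ)
  exact integral_eq_zero_of_mem_cuspForms_cm_two L μ 𝔓 i
    (h𝔓.trans (congrArg (Subgroup.comap (adelicVal (↥(maximalRealSubfield L)) L (IsCMField.complexConj L) 2 ((StdForm.antidiagonal 2).over L)))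
      (K2E1SiegelRadicalCocompactU2.upperUnitriangular_eq_standardUnipotentRadical_two (AdeleRing (𝓞 L) L)).symm))

/-- `N = 3`, `J` ANY form equal to `(StdForm.antidiagonal 3).over L`: cusp forms of `U(J)` whose radical at `i` is the FULL Heisenberg radical `U(J) ∩ R_u(P_{(1,1,1)})` (the printed
cusp condition, ★ `flagUnipotentRadical 3 1`) have mean zero (§4 + the dictionary ★ `upperUnitriangular_eq_flagUnipotentRadical_three`). [cite: MoeglinWaldspurger1995, I.2.18] -/
theorem integral_eq_zero_of_mem_cuspForms_of_over_eq_three {J : Matrix (Fin 3) (Fin 3) L} (hJ : (StdForm.antidiagonal 3).over L = J)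
    (μ : Measure (cmDatum L 3 J).automorphicQuotient) [(cmDatum L 3 J).IsAutomorphicMeasure μ]
    (𝔓 : (cmDatum L 3 J).ParabolicUnipotentData) (i : 𝔓.ι)
    (h𝔓 : 𝔓.radical i = (flagUnipotentRadical 3 1 (AdeleRing (𝓞 L) L)).comap (adelicVal (↥(maximalRealSubfield L)) L (IsCMField.complexConj L) 3 J)) :
    ∀ φ ∈ (cmDatum L 3 J).cuspForms μ 𝔓, ∫ x, φ x ∂μ = 0 := by
  subst hJ
  letI : MeasurableSpace (quasiSplit (↥(maximalRealSubfield L)) L (IsCMField.complexConj L) 3).Adelic := borel _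
  haveI : BorelSpace (quasiSplit (↥(maximalRealSubfield L)) L (IsCMField.complexConj L) 3).Adelic := ⟨rfl⟩
  haveI : (quasiSplit (↥(maximalRealSubfield L)) L (IsCMField.complexConj L) 3).IsAutomorphicMeasure μ :=
    inferInstanceAs ((cmDatum L 3 ((StdForm.antidiagonal 3).over L)).IsAutomorphicMeasure μ)
  exact integral_eq_zero_of_mem_cuspForms_cm_three L μ 𝔓 i
    (h𝔓.trans (congrArg (Subgroup.comap (adelicVal (↥(maximalRealSubfield L)) L (IsCMField.complexConj L) 3 ((StdForm.antidiagonal 3).over L)))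
      (K2E1HeisenbergRadicalCocompactU3.upperUnitriangular_eq_flagUnipotentRadical_three (AdeleRing (𝓞 L) L)).symm))

variable (μ₂ : Measure (cmDatum L 2 (Matrix.of fun i j : Fin 2 => if i.val + j.val + 1 = 2 then (1 : L) else 0)).automorphicQuotient)
  [(cmDatum L 2 (Matrix.of fun i j : Fin 2 => if i.val + j.val + 1 = 2 then (1 : L) else 0)).IsAutomorphicMeasure μ₂]
  (μ₃ : Measure (cmDatum L 3 (Matrix.of fun i j : Fin 3 => if i.val + j.val + 1 = 3 then (1 : L) else 0)).automorphicQuotient)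
  [(cmDatum L 3 (Matrix.of fun i j : Fin 3 => if i.val + j.val + 1 = 3 then (1 : L) else 0)).IsAutomorphicMeasure μ₃]

/-- **`hmean` FOR `U(Φ₂)` — THE EXACT LETTER OF ★ `span_const_le_cmResidualSubspace`, PAID: every cusp form in `cmCuspForms L 2 μ` (the route's literal datum `cmDatum L 2 Φ₂`, Siegel
parabolic data ★ `cmParabolicData L 2`) has `∫_X φ dμ = 0`** (transport along ★ `antidiagOne_eq_over`; the radical at `k = 1` is the comap of `standardUnipotentRadical 2 1` by definition).
[cite: MoeglinWaldspurger1995, I.2.18] [cite: BorelJacquet1979, §4.4–§4.6] -/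
theorem hmean_cm_two : ∀ φ ∈ cmCuspForms L 2 μ₂, ∫ x, φ x ∂μ₂ = 0 :=
  integral_eq_zero_of_mem_cuspForms_of_over_eq_two L (antidiagOne_eq_over (L := L) (N := 2)).symm μ₂ (cmParabolicData L 2) ⟨1, le_rfl, le_rfl⟩ rfl

/-- **`hmean` FOR `U(Φ₃)` ALONG THE PRINTED (FULL HEISENBERG) RADICAL: every cusp form in ★ `cmCuspFormsR L 3 μ` has `∫_X φ dμ = 0`** (the route's literal datum `cmDatum L 3 Φ₃`, repaired
parabolic data ★ `cmParabolicDataR L 3`; transport along ★ `antidiagOne_eq_over`).  (The centre-only class `cmCuspForms L 3 μ` ⊇-question is not addressed here.)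
[cite: MoeglinWaldspurger1995, I.2.18] [cite: BorelJacquet1979, §4.4–§4.6] -/
theorem hmean_cm_threeR : ∀ φ ∈ cmCuspFormsR L 3 μ₃, ∫ x, φ x ∂μ₃ = 0 :=
  integral_eq_zero_of_mem_cuspForms_of_over_eq_three L (antidiagOne_eq_over (L := L) (N := 3)).symm μ₃ (cmParabolicDataR L 3) ⟨1, le_rfl, by norm_num⟩ rfl

/-- **THE CONSTANT LINE OF `L²(U(Φ₂)(L⁺)∖U(Φ₂)(𝔸_{L⁺}))` IS RESIDUAL — LETTER-FREE: `ℂ ∙ 𝟙 ≤ L²_res = L²_disc ⊓ (L²_cusp)ᗮ`** (★ `span_const_le_cmResidualSubspace` with its one letter `hmean` paid by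
`hmean_cm_two`): rung (ρ2) «residual ∋ constants» at `N = 2`, unconditional. [cite: MoeglinWaldspurger1995, I.2.18] [cite: Rogawski1990, §13.5] -/
theorem span_const_le_cmResidualSubspace_two :
    (ℂ ∙ (Lp.const 2 μ₂ (1 : ℂ) : (cmDatum L 2 (Matrix.of fun i j : Fin 2 => if i.val + j.val + 1 = 2 then (1 : L) else 0)).L2 μ₂)) ≤ (cmResidualSubspace L 2 μ₂).toSubmodule :=
  span_const_le_cmResidualSubspace L 2 μ₂ (hmean_cm_two L μ₂)

/-- **THE CONSTANT LINE OF `L²(U(Φ₃)(L⁺)∖U(Φ₃)(𝔸_{L⁺}))` IS RESIDUAL — LETTER-FREE, PRINTED RADICALS: `ℂ ∙ 𝟙 ≤ L²_res = L²_disc ⊓ (L²_cusp)ᗮ`** for ★ `cmResidualSubspaceR L 3 μ` (★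
`span_const_le_residualSubspace` at `(cmDatum L 3 Φ₃, cmParabolicDataR L 3)` with `hmean` paid by `hmean_cm_threeR`): rung (ρ2)₃ «residual ∋ constants», unconditional.
[cite: MoeglinWaldspurger1995, I.2.18] [cite: Rogawski1990, §13.5] -/
theorem span_const_le_cmResidualSubspaceR_three :
    (ℂ ∙ (Lp.const 2 μ₃ (1 : ℂ) : (cmDatum L 3 (Matrix.of fun i j : Fin 3 => if i.val + j.val + 1 = 3 then (1 : L) else 0)).L2 μ₃)) ≤ (cmResidualSubspaceR L 3 μ₃).toSubmodule :=
  span_const_le_residualSubspace _ μ₃ (cmParabolicDataR L 3) (hmean_cm_threeR L μ₃)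

end Literal


end Summit.HodgeConjecture.HodgeConjecture.Cruxes.H413.K2E1CuspFormsMeanZeroSoftUCM

end
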